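import Summits.Ventures.Crystal3D.Theorems.StickyWulffConstantTextureBuildHealSurgery
import HarnessLib

/-!
# TB-1 brick L-HEAL, site surgery with a CLEAN COLLAR: the bill is `≤ −hd(blockers) ≤ 0` (no cut terms)
# (lane T, crux `TextureLiminfV5`, stmt-Ventures-23912; memo HOME/wulff-p2/g24/HEAL-g24.md §3/§4)

HONEST FRAMING. Venture `Summits/Ventures/Crystal3D` (cell `crystal3d-full`), route `route-Ventures-StickyWulffConstant`, helper `--supports` the
law-v5 crux `TextureLiminfV5` (stmt-Ventures-23912).  Pure finite combinatorics over '…TextureBuildHealSurgery' (census-free, standard axioms).  Nothing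
about any cover or texture is claimed; F-C1 not moved.

`exists_site_heal` ('…HealSurgery') occupies a prescribed finite site set `W ⊆ S` and bills `−hd(R) + ½·(abandoned adjacencies + severed contacts)`.  When
the window is chosen with a CLEAN COLLAR — every `S`-site within `3` of `W` outside `W` is a ball (`hcollar`), and no off-lattice ball outside the blocker
set touches a blocker (`hRclosed`) — all three cut terms vanish:

* `abandoned_eq_zero_of_collar` — at a refilled site, and at a kept lattice ball touching a blocker, there is no abandoned adjacency;
* **`exists_site_heal_clean`** — the healed packing has `6N' − b(x') ≤ 6N − b(x) − Σ_{a ∈ R} halfDefect a ≤ 6N − b(x)`, every site of `W` occupied,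
  `range x'` exact, `N ≤ N' + #R`.  This is the site-surgery analogue of '…Heal's `contactDeficiency_heal_le` (no full-coordination bookkeeping, any junk):
  the form used for thin features lying ENTIRELY inside the window (no cut), e.g. a whisker shorter than the window height or a floating segment.
-/

noncomputable section

namespace Summit.Ventures.Crystal3D.Theorems

open Finset Summit.Ventures.Crystal3D
open Literature.MathematicalPhysics.StatisticalMechanics (IsHaggSeq contactDeficiency)
open Summit.Ventures.Crystal3D.Cruxes.TextureLiminf.TexShadow (E3 stacking one_le_dist_of_mem_stacking)

section Clean

variable {N : ℕ} {x : Fin N → E3} {L : E3 ≃ₗᵢ[ℝ] E3} {s : E3} {σ : ℤ → ℤ}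

/-- With a clean `3`-collar, a point within `2` of `W` (a refilled site, or a kept ball touching a blocker) has NO abandoned adjacency: each of its touching
`S`-sites is in `W` (hence refilled or a kept lattice ball) or in the collar (hence a kept lattice ball). -/
theorem abandoned_eq_zero_of_collar (W R V : Finset E3)
    (hRdef : ∀ a, a ∈ R ↔ a ∈ Set.range x ∧ a ∉ stacking L s σ ∧ ∃ w ∈ W, dist a w < 1)
    (hVdef : ∀ v, v ∈ V ↔ v ∈ W ∧ v ∉ Set.range x)
    (hcollar : ∀ w ∈ stacking L s σ, w ∉ W → (∃ w' ∈ W, dist w w' ≤ 3) → w ∈ Set.range x)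
    {p : E3} (hp : ∃ w' ∈ W, dist p w' ≤ 2) :
    abandoned (stacking L s σ) (Finset.univ.image x \ R) V p = 0 := by
  classical
  unfold abandoned
  have hempty : {w | w ∈ stacking L s σ ∧ dist p w = 1 ∧ w ∉ Finset.univ.image x \ R ∧ w ∉ V} = (∅ : Set E3) := by
    ext w
    simp only [Set.mem_setOf_eq, Set.mem_empty_iff_false, iff_false, not_and, not_not]
    intro hwS hdw hwK
    by_contra hwV
    obtain ⟨w', hw', hpw'⟩ := hp
    have hw3 : ∃ w' ∈ W, dist w w' ≤ 3 := ⟨w', hw', by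
      calc dist w w' ≤ dist w p + dist p w' := dist_triangle _ _ _
        _ ≤ 1 + 2 := add_le_add (by rw [dist_comm, hdw]) hpw'
        _ = 3 := by norm_num⟩
    have hwx : w ∈ Set.range x := by
      by_cases hwW : w ∈ W
      · by_contra h
        exact hwV ((hVdef w).2 ⟨hwW, h⟩)
      · exact hcollar w hwS hwW hw3
    refine hwK (Finset.mem_sdiff.2 ⟨mem_image_univ_iff_mem_range.2 hwx, fun hwR => ?_⟩)
    exact ((hRdef w).1 hwR).2.1 hwS
  rw [hempty, Set.ncard_empty]

open scoped Classical in
/-- **SITE SURGERY WITH A CLEAN COLLAR.**  See the module docstring. -/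
theorem exists_site_heal_clean (hx : IsUnitPacking x) (hσ : IsHaggSeq σ) (W R V : Finset E3) (hW : ∀ w ∈ W, w ∈ stacking L s σ)
    (hRdef : ∀ a, a ∈ R ↔ a ∈ Set.range x ∧ a ∉ stacking L s σ ∧ ∃ w ∈ W, dist a w < 1)
    (hVdef : ∀ v, v ∈ V ↔ v ∈ W ∧ v ∉ Set.range x)
    (hcollar : ∀ w ∈ stacking L s σ, w ∉ W → (∃ w' ∈ W, dist w w' ≤ 3) → w ∈ Set.range x)
    (hRclosed : ∀ i, x i ∉ stacking L s σ → (∃ a ∈ R, dist (x i) a = 1) → x i ∈ R) :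
    ∃ (N' : ℕ) (x' : Fin N' → E3), IsUnitPacking x' ∧
      Finset.univ.image x' = (Finset.univ.image x \ R) ∪ V ∧
      (∀ w ∈ W, w ∈ Set.range x') ∧
      (∀ y, y ∈ Set.range x' ↔
        (y ∈ Set.range x ∧ (y ∈ stacking L s σ ∨ ∀ w ∈ W, 1 ≤ dist y w)) ∨ y ∈ W) ∧
      6 * (N' : ℝ) - (numContacts x' : ℝ) ≤ 6 * (N : ℝ) - (numContacts x : ℝ) - ∑ a ∈ R, halfDefect (Finset.univ.image x) a ∧
      N ≤ N' + R.card := by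
  classical
  obtain ⟨N', x', hx', himg, hWocc, hrange, hbill, hcount⟩ := exists_site_heal hx hσ W R V hW hRdef hVdef
  refine ⟨N', x', hx', himg, hWocc, hrange, ?_, hcount⟩
  set X : Finset E3 := Finset.univ.image x with hXdef
  have hmemX : ∀ {a : E3}, a ∈ X ↔ a ∈ Set.range x := fun {a} => by
    rw [hXdef]; exact mem_image_univ_iff_mem_range
  -- (1) refilled sites have no abandoned adjacency
  have h1 : ∑ v ∈ V, (abandoned (stacking L s σ) (X \ R) V v : ℝ) = 0 := by
    refine Finset.sum_eq_zero fun v hv => ?_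
    have hvW := ((hVdef v).1 hv).1
    rw [abandoned_eq_zero_of_collar W R V hRdef hVdef hcollar ⟨v, hvW, by rw [dist_self]; norm_num⟩, Nat.cast_zero]
  -- (2) kept lattice balls touching a blocker have no abandoned adjacency
  have h2 : ∑ b ∈ (X \ R).filter (fun b => b ∈ stacking L s σ ∧ ∃ a ∈ R, dist b a = 1),
      (abandoned (stacking L s σ) (X \ R) V b : ℝ) = 0 := by
    refine Finset.sum_eq_zero fun b hb => ?_
    obtain ⟨-, -, a, ha, hba⟩ := Finset.mem_filter.1 hb
    obtain ⟨-, -, w, hw, haw⟩ := (hRdef a).1 ha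
    have hp : ∃ w' ∈ W, dist b w' ≤ 2 := ⟨w, hw, by
      calc dist b w ≤ dist b a + dist a w := dist_triangle _ _ _
        _ ≤ 1 + 1 := add_le_add hba.le haw.le
        _ = 2 := by norm_num⟩
    rw [abandoned_eq_zero_of_collar W R V hRdef hVdef hcollar hp, Nat.cast_zero]
  -- (3) no kept off-lattice ball touches a blocker
  have h3 : (crossCount ((X \ R).filter fun b => b ∉ stacking L s σ) R : ℝ) = 0 := by
    have : crossCount ((X \ R).filter fun b => b ∉ stacking L s σ) R = 0 := by
      unfold crossCount
      rw [Finset.card_eq_zero, Finset.filter_eq_empty_iff]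
      rintro ⟨b, a⟩ hba hd
      obtain ⟨hb, ha⟩ := Finset.mem_product.1 hba
      obtain ⟨hbK, hbS⟩ := Finset.mem_filter.1 hb
      obtain ⟨hbX, hbR⟩ := Finset.mem_sdiff.1 hbK
      obtain ⟨i, hi⟩ := hmemX.1 hbX
      refine hbR ?_
      rw [← hi] at hbS ⊢
      exact hRclosed i hbS ⟨a, ha, by rw [hi]; exact hd⟩
    rw [this, Nat.cast_zero]
  rw [h1, h2, h3] at hbill
  linarith

end Clean

end Summit.Ventures.Crystal3D.Theorems

end
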